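import Summits.HubbardSuperconductivity.HubbardSuperconductivity.Theorems.AnisotropyChordTransferFibre3LemmaV
import Summits.HubbardSuperconductivity.HubbardSuperconductivity.Theorems.AnisotropyChordTransferFibre3GroundUnique

/-!
# Route `AnisotropyChord` / H0 rotor rung: the GM₃ assembly with the witness and the redundant regime hypothesis removed

Consolidation of the GM₃ ∀L assembly after this generation's landings (`…Fibre3LemmaV`, `…Fibre3GroundExists`,
`…Fibre3GroundUnique`): 
* `Tplus_lt_of_mHole_nonneg`: the regime hypothesis `T⁺ < 2ε₁` of `gm3_of_cruxes_*` FOLLOWS from `0 ≤ mHole`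
  (`mHole = ε₁(1 − 5/V + 6/V²)/2 − T⁺`), so only `mHole ≥ 0` needs a Level-2 proof;
* **`gm3_of_hole2`** (`8 ≤ L`, `0 < Δ < 1`): GM₃ from HOLE₂(.75), the three β-free cruxes with constants `(c, a, b)`, and —
  for every ground profile (equivalently THE ground profile, `ground_unique`) — `mHole ≥ 0` and the side condition
  `fac·η_eff·(a + b/(2 + cos θ)) < c`; the ground profile itself is supplied by `exists_ground`, no witness is an input.
Prover seat `hubbard-h0-rotor-p1` g23; helper for stmt-HubbardSuperconductivity-19089 (`--supports`).
-/

set_option linter.dupNamespace false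
set_option autoImplicit false

noncomputable section

namespace Summit.HubbardSuperconductivity.HubbardSuperconductivity.Theorems.AnisotropyChord.Transfer.Fibre3

variable (L : ℕ) [NeZero L]

/-- `mHole ≥ 0 ⇒ T⁺ < 2ε₁` (`L ≥ 4`): the first regime hypothesis of the assembly is implied by the second. [folklore] -/
theorem Tplus_lt_of_mHole_nonneg (hL : 4 ≤ L) {Δ : ℝ} {f : Tor L → ℝ} (hm : 0 ≤ mHole L Δ f) :
    Tplus L Δ f < 2 * eps1 L := by
  unfold mHole at hm
  have hε : 0 < eps1 L := eps1_pos L hL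
  have hL' : (4 : ℝ) ≤ L := by exact_mod_cast hL
  have hV : (16 : ℝ) ≤ (L : ℝ) ^ 2 := by nlinarith
  have h1 : 1 - 5 / (L : ℝ) ^ 2 + 6 / ((L : ℝ) ^ 2) ^ 2 ≤ 2 := by
    have h5 : 0 ≤ 5 / (L : ℝ) ^ 2 := by positivity
    have h6 : 6 / ((L : ℝ) ^ 2) ^ 2 ≤ 6 / 256 := by
      apply div_le_div_of_nonneg_left (by norm_num) (by norm_num)
      nlinarith
    linarith
  have h2 : eps1 L * (1 - 5 / (L : ℝ) ^ 2 + 6 / ((L : ℝ) ^ 2) ^ 2) / 2 ≤ eps1 L := by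
    have := mul_le_mul_of_nonneg_left h1 hε.le
    linarith
  linarith

/-- ★ **GM₃ from HOLE₂(.75) and the three β-free cruxes** (`8 ≤ L`, `0 < Δ < 1`), the ground profile being supplied by
`exists_ground` and the regime input reduced to `mHole ≥ 0` plus the side condition, both asked of every ground profile
(there is exactly one, `ground_unique`). [folklore] -/
theorem gm3_of_hole2 (hL : 8 ≤ L) {Δ : ℝ} (hΔ0 : 0 < Δ) (hΔ1 : Δ < 1) (c a b : ℝ)
    (hH2 : TwoHoleGap L (3 / 4 * eps1 L))
    (hreg : ∀ lam2 : ℝ, ∀ f : Tor L → ℝ, IsGroundTwoMagnon L Δ lam2 f →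
      0 ≤ mHole L Δ f ∧ facMI L Δ f * etaEff L lam2 * (a + b / (2 + Real.cos (2 * Real.pi / L))) < c)
    (hKT1 : TrialGapAbs L Δ c) (hKT2a : LowShellGFormAbs L Δ a) (hKT2b : OffPoleTailAbs L Δ b) : GM3Fibre L Δ := by
  obtain ⟨lam2, f, hf⟩ := exists_ground L (by omega) Δ
  obtain ⟨hm, hside⟩ := hreg lam2 f hf
  exact gm3_closedRho_twoHoleGap L hL hΔ0 hΔ1 c a b hH2 hf (Tplus_lt_of_mHole_nonneg L (by omega) hm) hm hside
    hKT1 hKT2a hKT2b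

end Summit.HubbardSuperconductivity.HubbardSuperconductivity.Theorems.AnisotropyChord.Transfer.Fibre3

end
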